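import Literature.NumberTheory.QuadraticForms.SymplecticLatticePairSplitting
import HarnessLib

/-!
# The symplectic elementary-divisor theorem: two self-dual lattices of an alternating space over a discretely valued field
# have ADAPTED SYMPLECTIC BASES `L = ⊕ 𝒪xᵢ ⊕ 𝒪yᵢ`, `M = ⊕ 𝒪ϖ^{-aᵢ}xᵢ ⊕ 𝒪ϖ^{aᵢ}yᵢ` (Shimura 1963 §1; the lattice form of the
# Cartan decomposition `Sp_{2n}(K) = Sp_{2n}(𝒪) T Sp_{2n}(𝒪)`)

Topic `NumberTheory/QuadraticForms`; namespace `Literature.NumberTheory.QuadraticForms.SymplecticLatticePair` (lane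
`lit-hodgefound`, Track 2 foundations; seat `lit-hodgefound-p11`, generation 34, row g34-#4, file 2).  THEOREMS ONLY (D-0026):
no definition, no named fact, no instance, no notation.  Sequel of `SymplecticLatticePairSplitting` (the adapted hyperbolic pair
and the splitting of a hyperbolic plane for an ALTERNATING form, in the vocabulary of the tree's hermitian files
`Automorphic/HermitianLatticesLocal` / `…AdaptedPlane`: `IsUnimodularLattice B W L`, `IsHyperbolicPair`, `orth`, `orthInt`).

## The print

[Shimura1963AnalyticFamilies] G. Shimura, *On analytic families of polarized abelian varieties and automorphic functions*,
Ann. of Math. 78 (1963), §1 (lattices in an alternating space over the quotient field of a principal ideal domain / a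
discrete valuation ring, Prop. 1.6–1.7: for two lattices `L ⊇ M` maximal for the alternating form there is a symplectic basis
of `L` in which `M` is diagonal with «elementary divisors»); [AndrianovZhuravlev1995] A. N. Andrianov, V. G. Zhuravlev,
*Modular Forms and Hecke Operators*, Ch. 3 §3, Lemma 3.3.6 («symplectic divisors»: every double coset `Γ g Γ`,
`Γ = Sp_n(ℤ)` resp. `Sp_n(ℤ_p)`, contains a unique `diag(d₁, …, d_n; e₁, …, e_n)` with `dᵢ | dᵢ₊₁`, `dᵢeᵢ = μ(g)`);
[Kottwitz1992] §7, proof of Lemma 7.4 («the double cosets of `K` in `G(ℚ_p)` are in one-to-one correspondence with the orbits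
of `Ω_{ℚ_p}` on `X_*(S)`», Case C).  The hermitian model of the proof — a vector of maximal level, a partner, split the two
adapted hyperbolic planes, induct — is [Jacobowitz1962] §§4–5 and, in the tree, `HyperspecialUnitaryCartanFrames`.

## What is formalised

`K` a field with `Valued K ℤᵐ⁰`, `ϖ` a uniformiser (`v ϖ = exp (-1)`; no condition on the residue characteristic, no
completeness), `V` a finite-dimensional `K`-space, `B : BilinForm K V` ALTERNATING, `W ≤ V` a subspace, `L, M` two
`𝒪`-lattices unimodular (self-dual) in `W` for `B` (`IsUnimodularLattice B W L`, `IsUnimodularLattice B W M`).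

* **`exists_adapted_symplectic_basis`** — there are `n : ℕ`, families `x y : Fin n → V` and exponents `a : Fin n → ℕ` with:
  each `(xᵢ, yᵢ)` a hyperbolic pair (`B xᵢ xᵢ = B yᵢ yᵢ = 0`, `B xᵢ yᵢ = 1`), distinct pairs `B`-orthogonal,
  `L = span_𝒪 {xᵢ, yᵢ}` and `M = span_𝒪 {ϖ^{-aᵢ} xᵢ, ϖ^{aᵢ} yᵢ}` — the SYMPLECTIC ELEMENTARY-DIVISOR THEOREM for the pair
  `(L, M)` (the exponents `±aᵢ` are the relative invariants; for `W = V = K^{2n}`, `L = 𝒪^{2n}` and `M = g 𝒪^{2n}` with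
  `g ∈ Sp_{2n}(K)` this is the Cartan decomposition `g ∈ Sp_{2n}(𝒪) · diag(ϖ^{-a}, ϖ^{a}) · Sp_{2n}(𝒪)` in lattice form).
  Proof: strong induction on `finrank W`; `W = ⊥` is trivial; otherwise `SymplecticLatticePair.exists_adapted_hyperbolicPair_of_isAlt`
  gives `a₀` and a hyperbolic pair `x₀, y₀ ∈ L` with `ϖ^{-a₀}x₀, ϖ^{a₀}y₀ ∈ M`; `IsUnimodularLattice.restrict_of_isAlt` splits
  `L = (𝒪x₀ + 𝒪y₀) ⊔ L'` and `M = (𝒪ϖ^{-a₀}x₀ + 𝒪ϖ^{a₀}y₀) ⊔ M'` with `L'`, `M'` unimodular in the SAME `W' = W ∩ ⟨x₀, y₀⟩^⊥`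
  (`orth_smul`), of smaller dimension; prepend `(x₀, y₀, a₀)` to the bases of the induction hypothesis (`Fin.cons`).
* `exists_adapted_symplectic_basis_top` — the case `W = ⊤` (lattices in the whole space).
* `exists_symplectic_basis_of_isUnimodularLattice` — one unimodular lattice has a symplectic `𝒪`-basis (`M = L`, all `aᵢ = 0`).

Not formalised here (TODO, sequel): the matrix form for `Sp_{2n}(K)` / `GSp_{2n}(K)` (`k₁ g k₂ = diag`), sorting of the
exponents and their uniqueness (the tree's `WeylOrbitsSymplecticInGeneralLinear` gives the Weyl-orbit statement), lattices
self-dual up to a scalar (multiplier `≠` unit).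

## References
* [Shimura1963AnalyticFamilies] G. Shimura, Ann. of Math. 78 (1963) 149–192, §1 Prop. 1.6–1.7.
* [AndrianovZhuravlev1995] A. N. Andrianov, V. G. Zhuravlev, *Modular Forms and Hecke Operators*, Transl. Math. Monogr. 145
  (1995), Ch. 3 §3, Lemma 3.3.6.
* [Jacobowitz1962] R. Jacobowitz, *Hermitian forms over local fields*, Amer. J. Math. 84 (1962), §§4–5.
* [Omeara1963] O. T. O'Meara, *Introduction to Quadratic Forms* (1963), §82F.
* [Kottwitz1992] R. E. Kottwitz, J. AMS 5 (1992), §7 Lemma 7.4 (Case C).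
-/

noncomputable section

open scoped Valued WithZero
open LinearMap (BilinForm)

namespace Literature.NumberTheory.QuadraticForms.SymplecticLatticePair

open Literature.NumberTheory.Automorphic.HermitianLattice

variable {K : Type*} [Field K] [Valued K ℤᵐ⁰] {ϖ : K} {V : Type*} [AddCommGroup V] [Module K V]
  [FiniteDimensional K V] {B : BilinForm K V}

omit [Valued K ℤᵐ⁰] [FiniteDimensional K V] in
/-- The scaled family `i ↦ tᵢ • (Fin.cons x₀ x) i` is `Fin.cons (t₀ • x₀) (i ↦ tᵢ₊₁ • xᵢ)`. [cite: Omeara1963, §82F] -/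
private theorem smul_cons_eq {n : ℕ} (t : Fin (n + 1) → K) (x₀ : V) (x : Fin n → V) :
    (fun i => t i • (Fin.cons x₀ x : Fin (n + 1) → V) i) = Fin.cons (t 0 • x₀) (fun i => t i.succ • x i) := by
  funext i
  refine Fin.cases ?_ (fun j => ?_) i
  · rw [Fin.cons_zero, Fin.cons_zero]
  · rw [Fin.cons_succ, Fin.cons_succ]

/-- `{x₀, y₀} ∪ (S ∪ T) = (insert x₀ S) ∪ (insert y₀ T)`. [cite: Omeara1963, §82F] -/
private theorem pair_union_eq {α : Type*} (x₀ y₀ : α) (S T : Set α) :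
    ({x₀, y₀} : Set α) ∪ (S ∪ T) = insert x₀ S ∪ insert y₀ T := by
  ext z
  simp only [Set.mem_union, Set.mem_insert_iff, Set.mem_singleton_iff]
  tauto

/-- **The symplectic elementary-divisor theorem / adapted symplectic bases for a pair of self-dual lattices.**  `B` an
alternating form on the finite-dimensional `K`-space `V` (`K` discretely valued, `ϖ` a uniformiser), `L`, `M` unimodular
`𝒪`-lattices in the subspace `W` for `B`.  Then there are `n`, hyperbolic pairs `(xᵢ, yᵢ)`, pairwise orthogonal, and
exponents `aᵢ : ℕ` with `L = span_𝒪 {xᵢ, yᵢ ∣ i}` and `M = span_𝒪 {ϖ^{-aᵢ} xᵢ, ϖ^{aᵢ} yᵢ ∣ i}` — «a symplectic basis of `L` in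
which `M` is diagonal».  Lattice proof as printed: adapted hyperbolic pair, split both lattices off the same orthogonal
complement, induct on the dimension. [cite: Shimura1963AnalyticFamilies, §1 Prop. 1.6–1.7; AndrianovZhuravlev1995, Ch. 3 Lemma 3.3.6] -/
theorem exists_adapted_symplectic_basis (hϖ : Valued.v ϖ = WithZero.exp (-1 : ℤ)) (hBa : B.IsAlt)
    (W : Submodule K V) (L M : Submodule 𝒪[K] V) (hL : IsUnimodularLattice B W L) (hM : IsUnimodularLattice B W M) :
    ∃ (n : ℕ) (x y : Fin n → V) (a : Fin n → ℕ),
      (∀ i, IsHyperbolicPair B (x i) (y i)) ∧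
      (∀ i j, i ≠ j → B (x i) (x j) = 0 ∧ B (x i) (y j) = 0 ∧ B (y i) (x j) = 0 ∧ B (y i) (y j) = 0) ∧
      L = Submodule.span 𝒪[K] (Set.range x ∪ Set.range y) ∧
      M = Submodule.span 𝒪[K] (Set.range (fun i => (ϖ ^ a i)⁻¹ • x i) ∪ Set.range (fun i => (ϖ ^ a i) • y i)) := by
  have hϖ0 : ϖ ≠ 0 := fun h0 => by
    rw [h0, map_zero] at hϖ
    exact WithZero.coe_ne_zero hϖ.symm
  -- strong induction on `finrank K W`
  generalize hd : Module.finrank K W = d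
  induction d using Nat.strong_induction_on generalizing W L M with
  | _ d ih =>
  by_cases hW : W = ⊥
  · -- `W = 0`: both lattices are `0`
    subst hW
    have hL0 : L = ⊥ := eq_bot_iff.2 fun z hz => hL.le_span hz
    have hM0 : M = ⊥ := eq_bot_iff.2 fun z hz => hM.le_span hz
    refine ⟨0, Fin.elim0, Fin.elim0, Fin.elim0, fun i => i.elim0, fun i => i.elim0, ?_, ?_⟩
    · rw [hL0, Set.range_eq_empty, Set.empty_union, Submodule.span_empty]
    · rw [hM0, Set.range_eq_empty, Set.range_eq_empty, Set.empty_union, Submodule.span_empty]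
  · -- the adapted hyperbolic pair `(x₀, y₀)`, exponent `a₀`
    obtain ⟨a₀, x₀, y₀, hp, hx₀, hy₀, hx₀M, hy₀M⟩ := exists_adapted_hyperbolicPair_of_isAlt hϖ hBa hL hM hW
    have hP0 : ϖ ^ a₀ ≠ 0 := pow_ne_zero _ hϖ0
    have hp' : IsHyperbolicPair B ((ϖ ^ a₀)⁻¹ • x₀) ((ϖ ^ a₀) • y₀) := hp.smul hP0 rfl
    -- split both lattices
    obtain ⟨hL', hLdec⟩ := IsUnimodularLattice.restrict_of_isAlt hBa hL hp hx₀ hy₀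
    obtain ⟨hM', hMdec⟩ := IsUnimodularLattice.restrict_of_isAlt hBa hM hp' hx₀M hy₀M
    rw [orth_smul (inv_ne_zero hP0) hP0, orthInt_smul (inv_ne_zero hP0) hP0] at hM'
    rw [orthInt_smul (inv_ne_zero hP0) hP0] at hMdec
    -- induction hypothesis on `W' = W ∩ ⟨x₀, y₀⟩^⊥`
    have hlt : Module.finrank K ↥(W ⊓ orth B x₀ y₀) < d :=
      hd ▸ finrank_inf_orth_lt_of_isAlt hBa hp (hL.le_span hx₀)
    obtain ⟨n, x, y, a, hhyp, horth, hLeq, hMeq⟩ := ih _ hlt (W ⊓ orth B x₀ y₀) _ _ hL' hM' rfl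
    -- the vectors of the induction hypothesis are orthogonal to `x₀`, `y₀`
    have hmemL' : ∀ z, z ∈ Set.range x ∪ Set.range y → B x₀ z = 0 ∧ B y₀ z = 0 := fun z hz => by
      have hz' : z ∈ L ⊓ orthInt B x₀ y₀ := hLeq ▸ Submodule.subset_span hz
      exact mem_orthInt.1 hz'.2
    refine ⟨n + 1, Fin.cons x₀ x, Fin.cons y₀ y, Fin.cons a₀ a, ?_, ?_, ?_, ?_⟩
    · intro i
      refine Fin.cases ?_ (fun j => ?_) i
      · simpa only [Fin.cons_zero] using hp
      · simpa only [Fin.cons_succ] using hhyp j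
    · intro i j hij
      refine Fin.cases ?_ (fun k => ?_) i j hij
      · intro j hij
        refine Fin.cases (fun h => absurd rfl h) (fun l _ => ?_) j hij
        simp only [Fin.cons_zero, Fin.cons_succ]
        obtain ⟨h1, h2⟩ := hmemL' (x l) (Or.inl ⟨l, rfl⟩)
        obtain ⟨h3, h4⟩ := hmemL' (y l) (Or.inr ⟨l, rfl⟩)
        exact ⟨h1, h3, h2, h4⟩
      · intro j hij
        refine Fin.cases (fun _ => ?_) (fun l hkl => ?_) j hij
        · simp only [Fin.cons_zero, Fin.cons_succ]
          obtain ⟨h1, h2⟩ := hmemL' (x k) (Or.inl ⟨k, rfl⟩)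
          obtain ⟨h3, h4⟩ := hmemL' (y k) (Or.inr ⟨k, rfl⟩)
          refine ⟨?_, ?_, ?_, ?_⟩
          · rw [← hBa.neg_eq, h1, neg_zero]
          · rw [← hBa.neg_eq, h2, neg_zero]
          · rw [← hBa.neg_eq, h3, neg_zero]
          · rw [← hBa.neg_eq, h4, neg_zero]
        · simp only [Fin.cons_succ]
          exact horth k l fun h => hkl (congrArg Fin.succ h)
    · rw [Fin.range_cons, Fin.range_cons, hLdec, hLeq, ← Submodule.span_union, pair_union_eq]
    · rw [smul_cons_eq (fun i => (ϖ ^ (Fin.cons a₀ a : Fin (n + 1) → ℕ) i)⁻¹) x₀ x,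
        smul_cons_eq (fun i => ϖ ^ (Fin.cons a₀ a : Fin (n + 1) → ℕ) i) y₀ y]
      simp only [Fin.cons_zero, Fin.cons_succ]
      rw [Fin.range_cons, Fin.range_cons, hMdec, hMeq, ← Submodule.span_union, pair_union_eq]

/-- **Adapted symplectic bases for two self-dual lattices in the whole space** (`W = ⊤`): `L = span_𝒪 {xᵢ, yᵢ}`,
`M = span_𝒪 {ϖ^{-aᵢ} xᵢ, ϖ^{aᵢ} yᵢ}` with `(xᵢ, yᵢ)` pairwise orthogonal hyperbolic pairs — for `L = 𝒪^{2n}`, `M = g𝒪^{2n}`,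
`g ∈ Sp_{2n}(K)`, the Cartan decomposition of `Sp_{2n}(K)` relative to `Sp_{2n}(𝒪)` in lattice form.
[cite: Shimura1963AnalyticFamilies, §1 Prop. 1.6–1.7; AndrianovZhuravlev1995, Ch. 3 Lemma 3.3.6; Kottwitz1992, §7 Lemma 7.4] -/
theorem exists_adapted_symplectic_basis_top (hϖ : Valued.v ϖ = WithZero.exp (-1 : ℤ)) (hBa : B.IsAlt)
    (L M : Submodule 𝒪[K] V) (hL : IsUnimodularLattice B ⊤ L) (hM : IsUnimodularLattice B ⊤ M) :
    ∃ (n : ℕ) (x y : Fin n → V) (a : Fin n → ℕ),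
      (∀ i, IsHyperbolicPair B (x i) (y i)) ∧
      (∀ i j, i ≠ j → B (x i) (x j) = 0 ∧ B (x i) (y j) = 0 ∧ B (y i) (x j) = 0 ∧ B (y i) (y j) = 0) ∧
      L = Submodule.span 𝒪[K] (Set.range x ∪ Set.range y) ∧
      M = Submodule.span 𝒪[K] (Set.range (fun i => (ϖ ^ a i)⁻¹ • x i) ∪ Set.range (fun i => (ϖ ^ a i) • y i)) :=
  exists_adapted_symplectic_basis hϖ hBa ⊤ L M hL hM

/-- **A self-dual lattice of an alternating space has a symplectic `𝒪`-basis**: `L = span_𝒪 {xᵢ, yᵢ}` with pairwise orthogonal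
hyperbolic pairs `(xᵢ, yᵢ)` (the case `M = L` of the elementary-divisor theorem; the integral symplectic basis theorem over the
valuation ring, cf. the tree's matrix version `AlternatingLocalRing.exists_conj_eq`).
[cite: Shimura1963AnalyticFamilies, §1; Omeara1963, §82F] -/
theorem exists_symplectic_basis_of_isUnimodularLattice (hϖ : Valued.v ϖ = WithZero.exp (-1 : ℤ)) (hBa : B.IsAlt)
    (W : Submodule K V) (L : Submodule 𝒪[K] V) (hL : IsUnimodularLattice B W L) :
    ∃ (n : ℕ) (x y : Fin n → V),
      (∀ i, IsHyperbolicPair B (x i) (y i)) ∧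
      (∀ i j, i ≠ j → B (x i) (x j) = 0 ∧ B (x i) (y j) = 0 ∧ B (y i) (x j) = 0 ∧ B (y i) (y j) = 0) ∧
      L = Submodule.span 𝒪[K] (Set.range x ∪ Set.range y) := by
  obtain ⟨n, x, y, -, hhyp, horth, hLeq, -⟩ := exists_adapted_symplectic_basis hϖ hBa W L L hL hL
  exact ⟨n, x, y, hhyp, horth, hLeq⟩

end Literature.NumberTheory.QuadraticForms.SymplecticLatticePair

end
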